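import Summits.QuantumFields.YangMills.Theorems.ReplicaVarianceTiltHeightChiSqLAcIntegrable
import Literature.MathematicalPhysics.QuantumFieldTheory.Balaban1983to89.T3OneStepAveragingPlaquettes
import HarnessLib

/-!
# `FluctuationComparisonRegPrIntLUpperFibreLawOneStep` — THE UNGUARDED ONE-STEP UPPER FIBRE LAW FOR THE DESCENT `descendTo F ℰp J (J+1)` (letter UFL₁:
# the denominator of ⟨SMALL-MASS₁⟩ ∕ ⟨HAAR-TUBE₁⟩ on the σ-free path to PERS₁∘)
# (crux `UnitScaleTilt.FluctuationComparisonRegPrIntL`, stmt-QuantumFields-20520; LINE g22-2∕g22-4 row PERS₁∘; companion of ✓`…PersistenceSigmaFree`, ✓`…SectionTubeSplit`)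

Cell `ym3-torus` (YM ladder rung R3 = continuum SU(2) Yang–Mills on T³ — a RUNG, NOT the Clay problem: not d = 4, not infinite volume, not a mass gap);
width seat `ym-ust-20520-w3` (gen 18, LEAD-20520); helper `--supports stmt-QuantumFields-20520`.  THEOREMS ONLY (0 `def`, 0 `sorry`, default heartbeats).

WHAT.  ★★`exists_haar_preimage_descendTo_succ_le` ∕ ★`exists_map_descendTo_succ_le_smul` — for every three-torus family and level `J` there is `C < ∞` with
`dU_{J+1}(D⁻¹B) ≤ C·dU_J(B)` for measurable `B`, i.e. `(dU_{J+1}).map (descendTo F ℰp J (J+1)) ≤ C • dU_J` (product Haar measures): the push-forward of the fine Haar measure under ONE (0.4) exp-mean-log block averaging is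
dominated by the coarse Haar measure, with NO small-field guard on the data.  LOCATE (ym3-torus-px21 g13, 2026-08-30 06:08Z): everything is in the tree —
✓`HeightChiSqL.guardedFibreLaw_le_smul` (the guarded fibre laws of `ℰp` on `SU(2)` are dominated by Haar, hypothesis-free), ✓`HeightChiSqLOfFibreLawBound.
map_fieldMeasure_avgFun_le_of_guard` (⇒ the FULL push-forward bound `dU_j.map (avgFun ℰp) ≤ (C+1)^{#bonds} • dU_{j+1}`, the guard handled inside), lit ✓`descendTo_succ`
(`D_{J,J+1} = fieldShift ∘ avgFun`) and lit ✓`measurePreserving_fieldShift`; this file is the 40-line assembly in the persistence lane's letters — the HAAR edition of the internal step `hdU` of ym3-torus-px20 g11's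
✓`…SupTailFloorDepthOne.map_descendTo_succ_gibbsK_le_smul` (there for `Gibbs_{J+1} ≤ Z⁻¹·dU_{J+1}`, proved inline and not exported; credit px20), EXPORTED BY NAME — plus the setwise corollary
★`haar_preimage_descendTo_succ_le` (`dU_{J+1}(D⁻¹B) ≤ ofReal C·dU_J(B)`, real `C > 0`) that ✓`…PersistenceSigmaFree` ∕ px8 g14's ⟨SMALL-MASS₁⟩ road consume.
HONEST SCOPE.  Assembly of landed theorems; proves nothing of ⟨SMALL-MASS₁⟩'s numerator, ⟨UP⟩, ⟨LOW⟩, PERS₁∘, TUBE∘, LFR♯ᶜ∘, S2β, 20520; `YM3TorusSU2` NOT proved; the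
Yang–Mills mass gap is NOT proved.  HYP-SAT (cell RULING №42): hypothesis-free.
References: [Balaban1987RG1] (0.4) p. 253, (0.11) p. 253; [Balaban1985Averaging] (10) p. 19, Prop. 1 p. 22.
-/

noncomputable section

set_option autoImplicit false

open MeasureTheory Set
open scoped ENNReal NNReal
open Literature.MathematicalPhysics.QuantumFieldTheory.Balaban1983to89
open Literature.MathematicalPhysics.QuantumFieldTheory.Balaban1983to89.T3ContinuumYM3Torus
open Literature.MathematicalPhysics.QuantumFieldTheory.Balaban1983to89.T3LevelShift
open Literature.MathematicalPhysics.QuantumFieldTheory.Balaban1983to89.T3UnitLawDensityEML (ℰp measurableE_ℰp)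
open Literature.MathematicalPhysics.QuantumFieldTheory.Balaban1983to89.T3TiltDescent
open Literature.MathematicalPhysics.QuantumFieldTheory.Balaban1983to89.T3OneStepAveragingPlaquettes (descendTo_succ)
open Literature.MathematicalPhysics.QuantumFieldTheory.Balaban1983to89.BlockAveraging

namespace Summit.QuantumFields.YangMills.Theorems.FluctuationComparisonRegPrIntLUpperFibreLawOneStep

variable (F : T3Family)

/-- ★★ **THE UNGUARDED ONE-STEP UPPER FIBRE LAW, SETWISE**: for every level `J` there is `C < ∞` (in `ℝ≥0∞`) with `dU_{J+1}(D⁻¹B) ≤ C·dU_J(B)` for every measurable `B`,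
`D = descendTo F ℰp J (J+1)` — the push-forward of the fine product Haar measure under one exp-mean-log block averaging (read on the coarse lattice through `fieldShift`)
is dominated by the coarse product Haar measure, with NO guard on the data.  (✓`HeightChiSqL.guardedFibreLaw_le_smul` ∘ ✓`HeightChiSqLOfFibreLawBound.map_fieldMeasure_avgFun_le_of_guard`
∘ lit ✓`descendTo_succ` ∘ lit ✓`measurePreserving_fieldShift`, read on preimages.) [cite: Balaban1987RG1, (0.4) p.253 and (0.11) p.253; Balaban1985Averaging, (10) p.19] -/
theorem exists_haar_preimage_descendTo_succ_le (J : ℕ) :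
    ∃ C : ℝ≥0∞, C ≠ ⊤ ∧ ∀ (B : Set (GaugeField (F.P J) 0 (Matrix.specialUnitaryGroup (Fin 2) ℂ))), MeasurableSet B →
      fieldMeasure (F.P (J + 1)) 0 (Matrix.specialUnitaryGroup (Fin 2) ℂ) (descendTo F ℰp J (J + 1) (Nat.le_succ J) ⁻¹' B) ≤
        C * fieldMeasure (F.P J) 0 (Matrix.specialUnitaryGroup (Fin 2) ℂ) B := by
  obtain ⟨C, hC, hle⟩ := Summit.QuantumFields.YangMills.Theorems.HeightChiSqL.guardedFibreLaw_le_smul F J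
  have hj : 0 + 1 ≤ (F.P (J + 1)).m + (F.P (J + 1)).K := by
    show 0 + 1 ≤ F.m + (J + 1)
    omega
  have havg := Summit.QuantumFields.YangMills.Theorems.HeightChiSqLOfFibreLawBound.map_fieldMeasure_avgFun_le_of_guard
    (P := F.P (J + 1)) (j := 0) hj ℰp measurableE_ℰp hle
  -- the level identification `T^{(1)}` of run `J+1` ≃ `T^{(0)}` of run `J`
  have hsd : (F.PP F.m J).sitesPerDir 0 = (F.PP F.m (J + 1)).sitesPerDir 1 :=
    F.sitesPerDir_eq (m := F.m) (K := J) (j := 0) (m' := F.m) (K' := J + 1) (j' := 1) (by omega)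
  have hmp := measurePreserving_fieldShift (F := F) (G := Matrix.specialUnitaryGroup (Fin 2) ℂ) hsd
  have hf : Measurable (avgFun ℰp : GaugeField (F.PP F.m (J + 1)) 0 (Matrix.specialUnitaryGroup (Fin 2) ℂ) →
      GaugeField (F.PP F.m (J + 1)) (0 + 1) (Matrix.specialUnitaryGroup (Fin 2) ℂ)) := measurable_avgFun ℰp measurableE_ℰp
  refine ⟨(C + 1) ^ Fintype.card (PBond (F.P (J + 1)) (0 + 1)), ENNReal.pow_ne_top (by simpa using hC), fun B hB => ?_⟩
  -- the preimage under one descent step is the preimage of the shifted event under the averaging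
  have hpre : descendTo F ℰp J (J + 1) (Nat.le_succ J) ⁻¹' B =
      (avgFun ℰp : GaugeField (F.PP F.m (J + 1)) 0 (Matrix.specialUnitaryGroup (Fin 2) ℂ) →
        GaugeField (F.PP F.m (J + 1)) (0 + 1) (Matrix.specialUnitaryGroup (Fin 2) ℂ)) ⁻¹' (fieldShift hsd ⁻¹' B) := by
    ext U
    simp only [Set.mem_preimage, descendTo_succ]
    rfl
  have hB' : MeasurableSet (fieldShift hsd ⁻¹' B) := hmp.measurable hB
  calc fieldMeasure (F.P (J + 1)) 0 (Matrix.specialUnitaryGroup (Fin 2) ℂ) (descendTo F ℰp J (J + 1) (Nat.le_succ J) ⁻¹' B)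
      = fieldMeasure (F.PP F.m (J + 1)) 0 (Matrix.specialUnitaryGroup (Fin 2) ℂ)
          ((avgFun ℰp : GaugeField (F.PP F.m (J + 1)) 0 (Matrix.specialUnitaryGroup (Fin 2) ℂ) →
            GaugeField (F.PP F.m (J + 1)) (0 + 1) (Matrix.specialUnitaryGroup (Fin 2) ℂ)) ⁻¹' (fieldShift hsd ⁻¹' B)) := congrArg _ hpre
    _ = ((fieldMeasure (F.PP F.m (J + 1)) 0 (Matrix.specialUnitaryGroup (Fin 2) ℂ)).map
          (avgFun ℰp : GaugeField (F.PP F.m (J + 1)) 0 (Matrix.specialUnitaryGroup (Fin 2) ℂ) →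
            GaugeField (F.PP F.m (J + 1)) (0 + 1) (Matrix.specialUnitaryGroup (Fin 2) ℂ))) (fieldShift hsd ⁻¹' B) :=
        (Measure.map_apply hf hB').symm
    _ ≤ ((C + 1) ^ Fintype.card (PBond (F.P (J + 1)) (0 + 1)) •
          fieldMeasure (F.PP F.m (J + 1)) (0 + 1) (Matrix.specialUnitaryGroup (Fin 2) ℂ)) (fieldShift hsd ⁻¹' B) :=
        Measure.le_iff'.mp havg _
    _ = (C + 1) ^ Fintype.card (PBond (F.P (J + 1)) (0 + 1)) *
          fieldMeasure (F.PP F.m (J + 1)) 1 (Matrix.specialUnitaryGroup (Fin 2) ℂ) (fieldShift hsd ⁻¹' B) := by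
        rw [Measure.smul_apply, smul_eq_mul]
    _ = (C + 1) ^ Fintype.card (PBond (F.P (J + 1)) (0 + 1)) * fieldMeasure (F.P J) 0 (Matrix.specialUnitaryGroup (Fin 2) ℂ) B := by
        rw [hmp.measure_preimage hB.nullMeasurableSet]
        rfl

/-- ★ **MEASURE FORM**: `(dU_{J+1}).map (descendTo F ℰp J (J+1)) ≤ C • dU_J` for some `C < ∞`. [cite: Balaban1987RG1, (0.4) p.253; Balaban1985Averaging, (10) p.19] -/
theorem exists_map_descendTo_succ_le_smul (J : ℕ) :
    ∃ C : ℝ≥0∞, C ≠ ⊤ ∧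
      (fieldMeasure (F.P (J + 1)) 0 (Matrix.specialUnitaryGroup (Fin 2) ℂ)).map (descendTo F ℰp J (J + 1) (Nat.le_succ J)) ≤
        C • fieldMeasure (F.P J) 0 (Matrix.specialUnitaryGroup (Fin 2) ℂ) := by
  obtain ⟨C, hC, hle⟩ := exists_haar_preimage_descendTo_succ_le F J
  have hD : Measurable (descendTo F ℰp J (J + 1) (Nat.le_succ J)) := measurable_descendTo F ℰp measurableE_ℰp _
  refine ⟨C, hC, Measure.le_iff.mpr fun B hB => ?_⟩
  rw [Measure.map_apply hD hB, Measure.smul_apply, smul_eq_mul]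
  exact hle B hB

/-- ★ **REAL-CONSTANT FORM** (the currency of ✓`…PersistenceSigmaFree` ∕ ✓`…SectionTubeSplit`): there is a real `C > 0` with `dU_{J+1}(D⁻¹B) ≤ ofReal C·dU_J(B)` for every
measurable `B` — the denominator letter of ⟨SMALL-MASS₁⟩ ∕ ⟨HAAR-TUBE₁⟩. [cite: Balaban1987RG1, (0.4) p.253; Balaban1985Averaging, (10) p.19] -/
theorem haar_preimage_descendTo_succ_le (J : ℕ) :
    ∃ C : ℝ, 0 < C ∧ ∀ (B : Set (GaugeField (F.P J) 0 (Matrix.specialUnitaryGroup (Fin 2) ℂ))), MeasurableSet B →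
      fieldMeasure (F.P (J + 1)) 0 (Matrix.specialUnitaryGroup (Fin 2) ℂ) (descendTo F ℰp J (J + 1) (Nat.le_succ J) ⁻¹' B) ≤
        ENNReal.ofReal C * fieldMeasure (F.P J) 0 (Matrix.specialUnitaryGroup (Fin 2) ℂ) B := by
  obtain ⟨C, hC, hle⟩ := exists_haar_preimage_descendTo_succ_le F J
  refine ⟨C.toReal + 1, by positivity, fun B hB => ?_⟩
  have hCle : C ≤ ENNReal.ofReal (C.toReal + 1) :=
    calc C = ENNReal.ofReal C.toReal := (ENNReal.ofReal_toReal hC).symm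
      _ ≤ ENNReal.ofReal (C.toReal + 1) := ENNReal.ofReal_le_ofReal (by linarith)
  exact (hle B hB).trans (mul_le_mul_left hCle _)

end Summit.QuantumFields.YangMills.Theorems.FluctuationComparisonRegPrIntLUpperFibreLawOneStep

end
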